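import Summits.Ventures.PercRepro.C025ProfilePLDSixLiftNine
import Summits.Ventures.PercRepro.C025ProfilePLDFiveLiftCorollaries
import Summits.Ventures.PercRepro.C025ProfilePLDSolidLiftCorollaries
import Summits.Ventures.PercRepro.C025ProfilePLDPlaneLiftCorollaries
import Summits.Ventures.PercRepro.C025ProfilePLDUniformTwoLiftCorollaries
import Summits.Ventures.PercRepro.C025ProfilePLDRankThree
import Summits.Ventures.PercRepro.C025ProfilePLDSixLiftFiveCorollaries

/-!
# THE RANK-6 UNIFORM SUMMAND AT RANK ≤ 9: (PLD)-MATROIDS OF RANK ≤ 9 ⊕ U_{6,m} (night-3 g34)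

`proofs/NIGHT3-G34-FASTLIFT.md` §1.  With `PLDSixLift.pld_disjointSum_uniform_six_ge_12_of_eRank_le_9` — (PLD)(M) ∧ rank M ≤ 9 ⟹ (PLD)(M ⊕ U_{6,m}) for every
`m ≥ 12` — and the landed rank-3 bases ((PLD) for every matroid of rank ≤ 3, `PLDParExt.pld_of_eRank_le_three`; the lines, planes,
solids of g31/g32): (PLD), hence C-025 at every `(p, q)` on every truncation of `N ⊕ free points`, for `N` = «any (PLD)-matroid of
rank ≤ 9 ⊕ U_{6,m}», «rank ≤ 3 ⊕ u_{6,m′} with m′ ≥ 11 ⊕ U_{6,m}» (`m ≥ 12`).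
No `def`, no `instance`, no notation.  Axioms: standard.
-/

open scoped Matroid

namespace PercRepro

open Finset ThmH

namespace PLDSixLift

variable {α : Type} [DecidableEq α]

/-- C-025 AT EVERY `(p, q)` ON EVERY TRUNCATION OF «(PLD)-MATROID OF RANK ≤ 9 ⊕ U_{6,m} WITH m ≥ 12 ⊕ FREE POINTS». -/
theorem rls_truncate_disjointSum_six_freeOn_of_pld_nine (M : Matroid α) [M.Finite] (hr : M.eRank ≤ 9)
    (hPLD : ∀ lo hi δ Θ : ℕ, Θ ≤ lo + hi + δ → (lo = 0 ∨ lo + hi + δ ≤ Θ) →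
      (∑ I ∈ (gr M).powerset, (if lo ≤ (M.eRk (I : Set α)).toNat ∧ (M.eRk (I : Set α)).toNat ≤ hi ∧
          Θ ≤ (M.eRk ((gr M \ I : Finset α) : Set α)).toNat + (M.eRk (I : Set α)).toNat then
          ((M.eRk ((gr M \ I : Finset α) : Set α)).toNat).choose δ else 0)) ≤
        ∑ I ∈ (gr M).powerset, (if lo + δ ≤ (M.eRk ((gr M \ I : Finset α) : Set α)).toNat ∧
          (M.eRk ((gr M \ I : Finset α) : Set α)).toNat ≤ hi + δ then
          ((M.eRk ((gr M \ I : Finset α) : Set α)).toNat).choose δ else 0))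
    (F : Finset α) (hF : 12 ≤ F.card) (h : Disjoint M.E (@Matroid.truncate α (Matroid.freeOn (F : Set α)) (PLDTruncate.freeOn_finite' F) 6).E)
    (E₃ : Finset α) (h₃ : Disjoint (M.disjointSum (@Matroid.truncate α (Matroid.freeOn (F : Set α)) (PLDTruncate.freeOn_finite' F) 6) h).E (E₃ : Set α)) (r p q : ℕ) :
    haveI := PLDTruncate.freeOn_finite' F
    haveI := PLDClosure.disjointSum_finite' _ _ h
    haveI := PLDBridge.disjointSum_freeOn_finite _ E₃ h₃
    ThmN.RLS (PercRepro.Matroid.truncate ((M.disjointSum (@Matroid.truncate α (Matroid.freeOn (F : Set α)) (PLDTruncate.freeOn_finite' F) 6) h).disjointSum (Matroid.freeOn (E₃ : Set α)) h₃) r) p q := by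
  haveI := PLDTruncate.freeOn_finite' F
  haveI := PLDClosure.disjointSum_finite' _ _ h
  exact PLDBridge.rls_disjointSum_freeOn_of_pld _ E₃ h₃ r p q (pld_disjointSum_uniform_six_ge_12_of_eRank_le_9 M hr hPLD F hF h)

/-- (PLD) FOR «RANK ≤ 3 ⊕ U_{6,m′} WITH m′ ≥ 11 ⊕ U_{6,m} WITH m ≥ 12» (unconditional; the u_{6,m′} with m′ ≥ 11 first, then the rank-6 summand at rank ≤ 9). -/
theorem pld_disjointSum_six_six_of_eRank_le_three (M : Matroid α) [M.Finite] (h3 : M.eRank ≤ 3)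
    (F₁ : Finset α) (hF₁ : 11 ≤ F₁.card) (h₁ : Disjoint M.E (@Matroid.truncate α (Matroid.freeOn (F₁ : Set α)) (PLDTruncate.freeOn_finite' F₁) 6).E)
    (F₂ : Finset α) (hF₂ : 12 ≤ F₂.card)
    (h₂ : Disjoint (M.disjointSum (@Matroid.truncate α (Matroid.freeOn (F₁ : Set α)) (PLDTruncate.freeOn_finite' F₁) 6) h₁).E (@Matroid.truncate α (Matroid.freeOn (F₂ : Set α)) (PLDTruncate.freeOn_finite' F₂) 6).E) :
    haveI := PLDTruncate.freeOn_finite' F₁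
    haveI := PLDTruncate.freeOn_finite' F₂
    haveI := PLDClosure.disjointSum_finite' _ _ h₁
    haveI := PLDClosure.disjointSum_finite' _ _ h₂
    ∀ lo hi δ Θ : ℕ, Θ ≤ lo + hi + δ → (lo = 0 ∨ lo + hi + δ ≤ Θ) →
      (∑ I ∈ (gr ((M.disjointSum (@Matroid.truncate α (Matroid.freeOn (F₁ : Set α)) (PLDTruncate.freeOn_finite' F₁) 6) h₁).disjointSum (@Matroid.truncate α (Matroid.freeOn (F₂ : Set α)) (PLDTruncate.freeOn_finite' F₂) 6) h₂)).powerset, (if lo ≤ (((M.disjointSum (@Matroid.truncate α (Matroid.freeOn (F₁ : Set α)) (PLDTruncate.freeOn_finite' F₁) 6) h₁).disjointSum (@Matroid.truncate α (Matroid.freeOn (F₂ : Set α)) (PLDTruncate.freeOn_finite' F₂) 6) h₂).eRk (I : Set α)).toNat ∧ (((M.disjointSum (@Matroid.truncate α (Matroid.freeOn (F₁ : Set α)) (PLDTruncate.freeOn_finite' F₁) 6) h₁).disjointSum (@Matroid.truncate α (Matroid.freeOn (F₂ : Set α)) (PLDTruncate.freeOn_finite' F₂) 6) h₂).eRk (I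 : Set α)).toNat ≤ hi ∧
          Θ ≤ (((M.disjointSum (@Matroid.truncate α (Matroid.freeOn (F₁ : Set α)) (PLDTruncate.freeOn_finite' F₁) 6) h₁).disjointSum (@Matroid.truncate α (Matroid.freeOn (F₂ : Set α)) (PLDTruncate.freeOn_finite' F₂) 6) h₂).eRk ((gr ((M.disjointSum (@Matroid.truncate α (Matroid.freeOn (F₁ : Set α)) (PLDTruncate.freeOn_finite' F₁) 6) h₁).disjointSum (@Matroid.truncate α (Matroid.freeOn (F₂ : Set α)) (PLDTruncate.freeOn_finite' F₂) 6) h₂) \ I : Finset α) : Set α)).toNat + (((M.disjointSum (@Matroid.truncate α (Matroid.freeOn (F₁ : Set α)) (PLDTruncate.freeOn_finite' F₁) 6) h₁).disjointSum (@Matroid.truncate α (Matroid.freeOn (F₂ : Set α)) (PLDTruncate.freeOn_finite' F₂) 6) h₂).eRk (I : Set α)).toNat then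
          ((((M.disjointSum (@Matroid.truncate α (Matroid.freeOn (F₁ : Set α)) (PLDTruncate.freeOn_finite' F₁) 6) h₁).disjointSum (@Matroid.truncate α (Matroid.freeOn (F₂ : Set α)) (PLDTruncate.freeOn_finite' F₂) 6) h₂).eRk ((gr ((M.disjointSum (@Matroid.truncate α (Matroid.freeOn (F₁ : Set α)) (PLDTruncate.freeOn_finite' F₁) 6) h₁).disjointSum (@Matroid.truncate α (Matroid.freeOn (F₂ : Set α)) (PLDTruncate.freeOn_finite' F₂) 6) h₂) \ I : Finset α) : Set α)).toNat).choose δ else 0)) ≤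
        ∑ I ∈ (gr ((M.disjointSum (@Matroid.truncate α (Matroid.freeOn (F₁ : Set α)) (PLDTruncate.freeOn_finite' F₁) 6) h₁).disjointSum (@Matroid.truncate α (Matroid.freeOn (F₂ : Set α)) (PLDTruncate.freeOn_finite' F₂) 6) h₂)).powerset, (if lo + δ ≤ (((M.disjointSum (@Matroid.truncate α (Matroid.freeOn (F₁ : Set α)) (PLDTruncate.freeOn_finite' F₁) 6) h₁).disjointSum (@Matroid.truncate α (Matroid.freeOn (F₂ : Set α)) (PLDTruncate.freeOn_finite' F₂) 6) h₂).eRk ((gr ((M.disjointSum (@Matroid.truncate α (Matroid.freeOn (F₁ : Set α)) (PLDTruncate.freeOn_finite' F₁) 6) h₁).disjointSum (@Matroid.truncate α (Matroid.freeOn (F₂ : Set α)) (PLDTruncate.freeOn_finite' F₂) 6) h₂) \ I : Finset α) : Set α)).toNat ∧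
          (((M.disjointSum (@Matroid.truncate α (Matroid.freeOn (F₁ : Set α)) (PLDTruncate.freeOn_finite' F₁) 6) h₁).disjointSum (@Matroid.truncate α (Matroid.freeOn (F₂ : Set α)) (PLDTruncate.freeOn_finite' F₂) 6) h₂).eRk ((gr ((M.disjointSum (@Matroid.truncate α (Matroid.freeOn (F₁ : Set α)) (PLDTruncate.freeOn_finite' F₁) 6) h₁).disjointSum (@Matroid.truncate α (Matroid.freeOn (F₂ : Set α)) (PLDTruncate.freeOn_finite' F₂) 6) h₂) \ I : Finset α) : Set α)).toNat ≤ hi + δ then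
          ((((M.disjointSum (@Matroid.truncate α (Matroid.freeOn (F₁ : Set α)) (PLDTruncate.freeOn_finite' F₁) 6) h₁).disjointSum (@Matroid.truncate α (Matroid.freeOn (F₂ : Set α)) (PLDTruncate.freeOn_finite' F₂) 6) h₂).eRk ((gr ((M.disjointSum (@Matroid.truncate α (Matroid.freeOn (F₁ : Set α)) (PLDTruncate.freeOn_finite' F₁) 6) h₁).disjointSum (@Matroid.truncate α (Matroid.freeOn (F₂ : Set α)) (PLDTruncate.freeOn_finite' F₂) 6) h₂) \ I : Finset α) : Set α)).toNat).choose δ else 0) := by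
  haveI := PLDTruncate.freeOn_finite' F₁
  haveI := PLDTruncate.freeOn_finite' F₂
  haveI := PLDClosure.disjointSum_finite' _ _ h₁
  have h1 := PLDSixLift.pld_disjointSum_six_of_eRank_le_three M h3 F₁ hF₁ h₁
  have hr1 : (M.disjointSum (@Matroid.truncate α (Matroid.freeOn (F₁ : Set α)) (PLDTruncate.freeOn_finite' F₁) 6) h₁).eRank ≤ 9 := by
    rw [PLDTwoLiftGen.eRank_disjointSum]
    calc M.eRank + (@Matroid.truncate α (Matroid.freeOn (F₁ : Set α)) (PLDTruncate.freeOn_finite' F₁) 6).eRank ≤ 3 + 6 := add_le_add h3 (PLDSixLift.eRank_six_le F₁)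
      _ ≤ 9 := by norm_num
  exact pld_disjointSum_uniform_six_ge_12_of_eRank_le_9 _ hr1 h1 F₂ hF₂ h₂

/-- C-025 AT EVERY `(p, q)` ON EVERY TRUNCATION OF «RANK ≤ 3 ⊕ U_{6,m′} WITH m′ ≥ 11 ⊕ U_{6,m} WITH m ≥ 12 ⊕ FREE POINTS». -/
theorem rls_truncate_disjointSum_six_six_freeOn_of_eRank_le_three (M : Matroid α) [M.Finite] (h3 : M.eRank ≤ 3)
    (F₁ : Finset α) (hF₁ : 11 ≤ F₁.card) (h₁ : Disjoint M.E (@Matroid.truncate α (Matroid.freeOn (F₁ : Set α)) (PLDTruncate.freeOn_finite' F₁) 6).E)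
    (F₂ : Finset α) (hF₂ : 12 ≤ F₂.card)
    (h₂ : Disjoint (M.disjointSum (@Matroid.truncate α (Matroid.freeOn (F₁ : Set α)) (PLDTruncate.freeOn_finite' F₁) 6) h₁).E (@Matroid.truncate α (Matroid.freeOn (F₂ : Set α)) (PLDTruncate.freeOn_finite' F₂) 6).E)
    (E₃ : Finset α) (h₃ : Disjoint ((M.disjointSum (@Matroid.truncate α (Matroid.freeOn (F₁ : Set α)) (PLDTruncate.freeOn_finite' F₁) 6) h₁).disjointSum (@Matroid.truncate α (Matroid.freeOn (F₂ : Set α)) (PLDTruncate.freeOn_finite' F₂) 6) h₂).E (E₃ : Set α)) (r p q : ℕ) :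
    haveI := PLDTruncate.freeOn_finite' F₁
    haveI := PLDTruncate.freeOn_finite' F₂
    haveI := PLDClosure.disjointSum_finite' _ _ h₁
    haveI := PLDClosure.disjointSum_finite' _ _ h₂
    haveI := PLDBridge.disjointSum_freeOn_finite _ E₃ h₃
    ThmN.RLS (PercRepro.Matroid.truncate (((M.disjointSum (@Matroid.truncate α (Matroid.freeOn (F₁ : Set α)) (PLDTruncate.freeOn_finite' F₁) 6) h₁).disjointSum (@Matroid.truncate α (Matroid.freeOn (F₂ : Set α)) (PLDTruncate.freeOn_finite' F₂) 6) h₂).disjointSum (Matroid.freeOn (E₃ : Set α)) h₃) r) p q := by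
  haveI := PLDTruncate.freeOn_finite' F₁
  haveI := PLDTruncate.freeOn_finite' F₂
  haveI := PLDClosure.disjointSum_finite' _ _ h₁
  haveI := PLDClosure.disjointSum_finite' _ _ h₂
  exact PLDBridge.rls_disjointSum_freeOn_of_pld _ E₃ h₃ r p q
    (pld_disjointSum_six_six_of_eRank_le_three M h3 F₁ hF₁ h₁ F₂ hF₂ h₂)
end PLDSixLift

end PercRepro
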